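import Summits.BirchSwinnertonDyer.BirchSwinnertonDyer.Theses.AdditiveBranchIMC
import HarnessLib

/-!
# Route `AdditiveBranchIMC` (rung K1): the `#Ш_an`-UNIT WINDOW read on the route's OTHER lower-half cruxes —
# `GordHigherLower` (item 19360, defect `3,4,6`, declared RESIDUAL) and `MultLower` (item 19359, cell (M)) BY NAME,
# reduced to their CONTENT WINDOWS `p ∣ #Ш(E)_an`
# (cell `bsd-addord`, seat `bsd-addord-k1-c3` gen 5; `--supports stmt-BirchSwinnertonDyer-19360 --as helper`)

HONEST FRAMING. THEOREMS ONLY (three, all excluded middle): no definition, no named fact, no `sorry`, nothing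
booked, BSD not proved; items 19359 / 19360 stay OPEN — this file only DISPLAYS their open part in the cell's
content-window vocabulary (TARGET §2). Companion of `…GordTwoRankOneShaAnUnit` (same seat, item 19358), whose §0
observation is class-free: the common currency of the three K1 lower-half cruxes,
`Typed.MissingLowerBoundAt W p := ∃ q : ℚ, shaAn W = q ∧ padicValRat p q ≤ padicValNat p #Ш(E)`, holds with NO
input on every pair carrying the per-pair datum "`#Ш(E)_an = s ∈ ℚ`, `ord_p s ≤ 0`" (in analytic rank `0` the
value `#Ш(E)_an` is the exact rational of Manin–Drinfeld / modular symbols; in rank `1` it is rational by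
Gross–Zagier I.(7.3) and its value is table data, the F3BW currency of
`Typed.bsdp_of_card_selmerGroup_eq_pow_analyticRank`). Hence:

* `gordHigherLower_of_window` — `GordHigherLower` (∀ `E` of analytic rank `≤ 1`, ∀ odd additive (G)-ordinary `p`
  with `e ∈ {3,4,6}`: `ord_p #Ш_an ≤ ord_p #Ш`) ⟸ its own statement DISPLAYED on the content window (every rational
  value of `#Ш(E)_an` has positive `p`-valuation). The defect-`3,4,6` corner has NO `p`-adic `L`-function in the
  tree (Delbourgo 1998 p. 150), so off the window nothing else is available; ON the unit window nothing is needed.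
* `multLower_of_window` — the same for `MultLower` (cell (M), k1-c4's item 19359; its r0 residual was already
  phrased as `p ∣ #Ш_an` by k1-c2/k1-c4 — this is the by-name form, both ranks).
* `lowerHalf_of_window` — the class-free core both are instances of.

References: [Miller2011LMS] §1, Def. 1.1; [Delbourgo1998] p. 150; [GrossZagier1986] I.(7.3); cell TARGET.md §2.
-/

set_option autoImplicit false
set_option linter.dupNamespace false
noncomputable section
open scoped Classical
open WeierstrassCurve Literature.NumberTheory.EllipticCurves
  Literature.NumberTheory.EllipticCurves.Rank1Residual
  Literature.NumberTheory.EllipticCurves.Rank1Residual.Typed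
  Summit.BirchSwinnertonDyer.Rank1Residual.Additive
  Summit.BirchSwinnertonDyer.BirchSwinnertonDyer.Theses.AdditiveBranchIMC

namespace Summit.BirchSwinnertonDyer.BirchSwinnertonDyer.Theorems.AdditiveBranchIMCLowerHalfWindow

/-- **Class-free core: the lower half off the content window.** For any `W`, any `p`: either some rational value
`s` of `#Ш(E)_an` has `ord_p s ≤ 0` — then `Typed.MissingLowerBoundAt W p` holds (the right side
`padicValNat p #Ш(E)` is a natural number) — or the pair is in the CONTENT WINDOW. So a lower-half statement on
any class of pairs follows from itself restricted to the window. [cite: Miller2011LMS, §1 and Def. 1.1] -/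
theorem lowerHalf_of_window (W : WeierstrassCurve ℚ) (p : ℕ)
    (hwin : (∀ s : ℚ, shaAn W = (s : ℂ) → 0 < padicValRat p s) → MissingLowerBoundAt W p) :
    MissingLowerBoundAt W p := by
  by_cases h : ∃ s : ℚ, shaAn W = (s : ℂ) ∧ padicValRat p s ≤ 0
  · obtain ⟨s, hs, hsv⟩ := h
    exact ⟨s, hs, hsv.trans (by positivity)⟩
  · push Not at h
    exact hwin h

/-- **Crux `GordHigherLower` (item 19360, defect `3,4,6`, declared RESIDUAL) BY NAME, reduced to its content
window**: GRANTED its own statement on the pairs of cell `N10.CellGordHigher` of analytic rank `≤ 1` whose every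
rational value of `#Ш(E)_an` has POSITIVE `p`-valuation (`hWindow`, DISPLAYED — the open part), the route decl
follows; on the unit window (`ord_p #Ш_an ≤ 0`, per-pair datum) it holds with no input.
[cite: Miller2011LMS, §1 and Def. 1.1] [cite: Delbourgo1998, §2.5 (p. 150)] -/
theorem gordHigherLower_of_window
    (hWindow : ∀ (W : WeierstrassCurve ℚ) [W.IsElliptic] [W.IsGloballyMinimal] (p : ℕ) [Fact p.Prime],
      W.analyticRank ≤ 1 → N10.CellGordHigher W p → (∀ s : ℚ, shaAn W = (s : ℂ) → 0 < padicValRat p s) →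
      MissingLowerBoundAt W p) :
    GordHigherLower :=
  fun W _ _ p _ hr hc ↦ lowerHalf_of_window W p (hWindow W p hr hc)

/-- **Crux `MultLower` (item 19359, cell (M)) BY NAME, reduced to its content window** (both analytic ranks):
GRANTED its own statement on the pairs of `N10.CellM` of analytic rank `≤ 1` in the content window (`hWindow`,
DISPLAYED), the route decl follows. [cite: Miller2011LMS, §1 and Def. 1.1] -/
theorem multLower_of_window
    (hWindow : ∀ (W : WeierstrassCurve ℚ) [W.IsElliptic] [W.IsGloballyMinimal] (p : ℕ) [Fact p.Prime],
      W.analyticRank ≤ 1 → N10.CellM W p → (∀ s : ℚ, shaAn W = (s : ℂ) → 0 < padicValRat p s) →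
      MissingLowerBoundAt W p) :
    MultLower :=
  fun W _ _ p _ hr hc ↦ lowerHalf_of_window W p (hWindow W p hr hc)

end Summit.BirchSwinnertonDyer.BirchSwinnertonDyer.Theorems.AdditiveBranchIMCLowerHalfWindow

end
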